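import Summits.RiemannHypothesis.RiemannHypothesis.Theorems.GroundBartaEvenWinsBeyondArchDeflationM77OddLowerG
import Summits.RiemannHypothesis.RiemannHypothesis.Theorems.GroundBartaEvenWinsBeyondArchDeflationM78FOddLowerGW
import Summits.RiemannHypothesis.RiemannHypothesis.Theorems.WeilParityEvenWinsBeyondArchFrontier78OfOddLower
import HarnessLib

/-!
# RiemannHypothesis / GroundBarta — rung 4: the parity ladder reaches `39/50`

Helper file (`--supports stmt-RiemannHypothesis-18085`), RH-free.  Provers A (g4 template, g5) and B (R-layers).  The four cell L-sides
`m72_oddLower_lit`, `m75_oddLower_lit`, `m77_oddLower_lit` and `m78F_oddLower_litW : 1/32e12 < 33/10^15 ≤ ε_od(39/50)` (cell `[77/100, 39/50]`,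
weighted cross-Gram criterion, file …DeflationM78FOddLowerGW) close `WeilWindowSimpleEven` on `(0, 39/50]` via `weilWindowSimpleEven_of_le_M78_of_oddLower`.
-/

noncomputable section

namespace Summit.RiemannHypothesis.RiemannHypothesis.Theorems.EvenWinsBeyondArch

open Literature.NumberTheory.LFunctions

/-- **`WeilWindowSimpleEven a` for every `0 < a ≤ 39/50`** (cells `[2/3,18/25]`, `[18/25,3/4]`, `[3/4,77/100]`, `[77/100,39/50]`). [folklore] -/
theorem weilWindowSimpleEven_upTo_M78 : ∀ a : ℝ, 0 < a → a ≤ 39 / 50 → WeilWindowSimpleEven a :=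
  weilWindowSimpleEven_of_le_M78_of_oddLower m72_oddLower_lit.1 m72_oddLower_lit.2 m75_oddLower_lit.1 m75_oddLower_lit.2
    m77_oddLower_lit.1 m77_oddLower_lit.2 m78F_oddLower_litW.1 m78F_oddLower_litW.2

/-- Tail shape of item 18085 up to `39/50`. [folklore] -/
theorem tailSimpleEven_upTo_M78 : ∀ a : ℝ, Real.log 2 < a → a ≤ 39 / 50 → WeilWindowSimpleEven a :=
  fun a ha hle ↦ weilWindowSimpleEven_upTo_M78 a ((Real.log_pos (by norm_num)).trans ha) hle

end Summit.RiemannHypothesis.RiemannHypothesis.Theorems.EvenWinsBeyondArch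

end
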